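import Summits.BirchSwinnertonDyer.BirchSwinnertonDyer.Theorems.AdditiveBranchIMCGordTwoRankZeroCompanion
import Summits.BirchSwinnertonDyer.Rank1Residual.Additive.GordRankZeroChiBranch
import Summits.BirchSwinnertonDyer.Rank1Residual.Additive.N10LowerHalfStatements
import Summits.BirchSwinnertonDyer.Rank1Residual.GaloisImage.KuriharaSelmerShaBookkeeping
import Literature.NumberTheory.EllipticCurves.Rank1Residual.Typed.CasselsLowerBound
import Literature.NumberTheory.EllipticCurves.HeegnerPointsKolyvaginExceptionalProofs
import HarnessLib

/-!
# Crux `GordTwoRankOne` (item 19358): the SELMER-COMPANION / VISIBILITY door in analytic rank ONE —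
# `ord_p #Ш(E)_an ≤ ord_p #Ш(E)` on CONTENT-window rows (`p ∣ #Ш(E)_an`, `ord_p #Ш_an ≤ 2`) of cell
# (G-ord, `e = 2`) ∩ `r_an = 1` from a `p`-congruent partner of rank `≥ 2` and TWO named rational points
# (NO `p`-adic `L`-value, NO Λ-adic input, NO Schneider / `A′ ≠ 0`, NO engine value)

Cell `bsd-addord`, seat `bsd-addord-k1-c3` (D-0074 row B2), gen 7. HONEST FRAMING: nothing here proves the
Birch–Swinnerton-Dyer conjecture or the crux (`GordTwoRankOne`, OPEN at class level on its Λ-adic children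
19497/19498 and the Schneider child 19499); THEOREMS ONLY (no definition, no named fact, no `sorry`); every
published input is an explicit named-fact binder; every per-pair input (the `p`-congruence `θ`, the two
witness points and their independence mod `p`, the finite set of places and their kinds, the twist models,
the datum `#Ш_an`) is a displayed binder decided OUTSIDE this file; nothing is booked by this file.

## The observation (gen 7)

The per-pair roads for `GordTwoRankOne` landed by this seat (gens 0–6) close a rank-one row of the cell from
ONE number `A′(E,p) ≠ 0` (first branch coefficient, two-engine certificate) — but only through the
LOWER-half identity, i.e. on the UNIT window `ord_p #Ш(E)_an = 0` (gen 5: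
`…GordTwoRankOneShaAnUnit`), where the lower half is in fact free. On the CONTENT window
`p ∣ #Ш(E)_an` (gen 5 census: 12 keys of the cell on Cremona's table, all at `p = 3`) the only landed
per-pair road is descent (`…ContentWindowDescent`: `9 ∣ #Sel₃(E)` as a displayed binder, no kernel
decider). Here is a second road, the rank-ONE twin of k1-c2's rank-zero companion door
(`…GordTwoRankZeroCompanion[Doors]`, item 19357): Cremona–Mazur visibility with TWO witnesses.

Let `E' = W'` be a `p`-congruent partner (`θ : E'[p] ⥲ E[p]` a `Γ_ℚ`-isomorphism) and
`P₁, P₂ ∈ E'(ℚ)` two points INDEPENDENT modulo `pE'(ℚ)` whose transported Kummer classes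
`θ_* κ'(P_i)` satisfy the local condition of `E` at every bad place (same per-place options as the
rank-zero door: (a) a `p`-th root in `E'(ℚ_w)`, (i) `w ∤ p ∧ E'(ℚ_w)[p] = 0`, (vi) `w ∣ p` — free by
Mazur–Rubin 2015 Thm. 3.1 for the twist `χ_{p*}`, both curves being `p*`-twists of curves good at `p`).
If `E(ℚ)/pE(ℚ)` is CYCLIC — which is the case in analytic rank one with `E[p]` irreducible
(Gross–Zagier–Kolyvagin: rank `E(ℚ) = 1`; Mordell–Weil; `E(ℚ)[p] = 0`; `#E(ℚ)/pE(ℚ) = p^{rank} = p`,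
tree `natCard_quotient_range_zsmul_eq`) — then `Ш(E)[p] ≠ 0`: the two visible classes `f(P₁), f(P₂)` lie
in `Ш(E)[p]` (`VisibleWitness.torsionH1ToH1_h1Equiv_kummerMapTorsion_mem_sha`); if both vanished,
`θ_* κ'(P_i) = κ(Q_i)` with `Q_i ≡ a_i G (mod pE(ℚ))`, so `θ_* κ'(a₂P₁ − a₁P₂) = 0`, i.e.
`a₂P₁ − a₁P₂ ∈ pE'(ℚ)`, whence `p ∣ a₁, a₂` by independence, whence `θ_* κ'(P₁) = a₁ κ(G) = 0` and
`P₁ ∈ pE'(ℚ)` — contradicting independence. Then Cassels–Tate squareness gives `p² ∣ #Ш(E)` and the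
crux's conclusion `MissingLowerBoundAt W p` AT THE PAIR whenever `ord_p #Ш(E)_an ≤ 2` — with NO Iwasawa
theory, NO `p`-adic `L`-value and NO `p`-adic height (the content window is exactly where the `A′`-road
is silent). A rank-`2` partner suffices (two independent points); its `λ` is not seen.

## What (class-free §1–§2 over a number field `K`; the cell's doors in §3)

* §1 algebra: `exists_generator_of_natCard_quotient_range_zsmul_le` — an abelian group `A` with
  `#(A/pA) ≤ p` has `A/pA` cyclic: `∃ G, ∀ Q, ∃ a R, Q = a • G + p • R`.
* §2 `exists_sha_ne_zero_of_congr_of_two_witnesses` — the TWO-WITNESS visibility theorem over any number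
  field `K` (n1011's `VisibleWitness.exists_sha_ne_zero_of_congr_of_witness` with `E(K) = pE(K)` replaced
  by `E(K)/pE(K)` cyclic and one witness by two independent ones).
* §3 the ℚ-doors on cell (G-ord, `e = 2`) ∩ {`E[p]` irreducible} ∩ `r_an = 1`, every odd `p` (`p = 3`
  included): `exists_sha_ne_zero_rankOne_irr_of_companionTwoWitnesses` (`Ш(E)[p] ≠ 0`) and
  `missingLowerBoundAt_rankOne_irr_of_companionTwoWitnesses` (the crux's conclusion at the pair, datum
  `ord_p #Ш_an ≤ 2`), binders `hCT hGZK hMRt` + per-pair data; and the crux-shaped reading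
  `cellGordTwo_missingLowerBoundAt_rankOne_of_companionTwoWitnesses`.

HONEST PRICE. The door bites on a content-window pair only if a `p`-congruent curve of rank `≥ 2` with
compatible bad places exists in range (per-pair search + certificate, EVIDENCE, outside the kernel); it
says nothing class-wide: the crux stays OPEN. LOWER half only.

References: Cremona–Mazur 2000 §3 [CremonaMazur2000]; Agashe–Stein 2002 Lemma 3.6 [AgasheStein2002];
Mazur–Rubin 2015 Thm. 3.1, §6 Case 5 [MazurRubin2015SelmerCompanions]; Gross 1991 §2 [GrossLMS1991];
Silverman AEC VIII.6.7, X.4.14 [SilvermanAEC2009]; Cassels 1962 / Tate 1963 (alternating pairing)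
[Cassels1962IV]; Gross–Zagier 1986, Kolyvagin 1990 (rank part) [GrossZagier1986, Kolyvagin1990Euler];
Miller 2011 Def. 1.1 [Miller2011LMS].
-/

set_option autoImplicit false

noncomputable section

open scoped Classical

open WeierstrassCurve Literature.NumberTheory.EllipticCurves
  Literature.NumberTheory.EllipticCurves.Rank1Residual
  Literature.NumberTheory.EllipticCurves.Rank1Residual.Typed
  Literature.NumberTheory.EllipticCurves.MazurRubin2015
  Literature.NumberTheory.GaloisRepresentations
  Summit.BirchSwinnertonDyer.Rank1Residual.GaloisImage
open NumberField IsDedekindDomain Rat.HeightOneSpectrum Field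
  Literature.NumberTheory.EllipticCurves.ModularForms

set_option linter.dupNamespace false

namespace Summit.BirchSwinnertonDyer.BirchSwinnertonDyer.Theorems.AdditiveBranchIMCGordTwoRankOneVisibility

open Summit.BirchSwinnertonDyer.Rank1Residual
open Summit.BirchSwinnertonDyer.Rank1Residual.Additive
open Summit.BirchSwinnertonDyer.BirchSwinnertonDyer.Theorems.AdditiveBranchIMCGordTwoRankZeroCompanion

/-! ## §1 Algebra: a quotient `A/pA` of order `≤ p` is cyclic -/

section Algebra

universe u

variable {A : Type u} [AddCommGroup A]

/-- **`#(A/pA) ≤ p` ⟹ `A/pA` is cyclic**, in the generator form used below: there is `G ∈ A` with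
`A = ℤG + pA`. (If `A = pA` take `G = 0`; otherwise any `G ∉ pA` has image of order `p` in `A/pA`, a
group of order `≤ p`, so its multiples exhaust `A/pA`.) [folklore] -/
theorem exists_generator_of_natCard_quotient_range_zsmul_le {p : ℕ} (hp : p.Prime)
    [Finite (A ⧸ (zsmulAddGroupHom (α := A) (p : ℤ)).range)]
    (h : Nat.card (A ⧸ (zsmulAddGroupHom (α := A) (p : ℤ)).range) ≤ p) :
    ∃ G : A, ∀ Q : A, ∃ (a : ℤ) (R : A), Q = a • G + (p : ℤ) • R := by
  set H := (zsmulAddGroupHom (α := A) (p : ℤ)).range with hH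
  -- every class of `A/H` is killed by `p`
  have hkill : ∀ x : A ⧸ H, p • x = 0 := by
    intro x
    induction x using QuotientAddGroup.induction_on with
    | H a =>
      rw [← QuotientAddGroup.mk_nsmul, QuotientAddGroup.eq_zero_iff, ← natCast_zsmul]
      exact ⟨a, rfl⟩
  by_cases htriv : ∀ Q : A, (Q : A ⧸ H) = 0
  · refine ⟨0, fun Q ↦ ?_⟩
    obtain ⟨R, hR⟩ := (QuotientAddGroup.eq_zero_iff Q).mp (htriv Q)
    exact ⟨0, R, by rw [zero_smul, zero_add]; exact hR.symm⟩
  · simp only [not_forall] at htriv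
    obtain ⟨G, hG⟩ := htriv
    refine ⟨G, fun Q ↦ ?_⟩
    -- the multiples of the class of `G` exhaust `A/H`
    have hord : addOrderOf (G : A ⧸ H) = p := by
      have hdvd : addOrderOf (G : A ⧸ H) ∣ p := addOrderOf_dvd_of_nsmul_eq_zero (hkill _)
      rcases (Nat.dvd_prime hp).mp hdvd with h1 | h1
      · exact absurd (AddMonoid.addOrderOf_eq_one_iff.mp h1) hG
      · exact h1
    have htop : AddSubgroup.zmultiples (G : A ⧸ H) = ⊤ := by
      apply AddSubgroup.eq_top_of_card_eq
      refine le_antisymm (AddSubgroup.card_le_card_addGroup _) ?_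
      rw [Nat.card_zmultiples, hord]
      exact h
    have hQ : (Q : A ⧸ H) ∈ AddSubgroup.zmultiples (G : A ⧸ H) := by rw [htop]; exact AddSubgroup.mem_top _
    obtain ⟨a, ha⟩ := AddSubgroup.mem_zmultiples_iff.mp hQ
    have hdiff : ((Q - a • G : A) : A ⧸ H) = 0 := by
      rw [QuotientAddGroup.mk_sub, QuotientAddGroup.mk_zsmul, ← ha, sub_self]
    obtain ⟨R, hR⟩ := (QuotientAddGroup.eq_zero_iff _).mp hdiff
    refine ⟨a, R, ?_⟩
    have hR' : (p : ℤ) • R = Q - a • G := hR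
    rw [hR', add_sub_cancel]

end Algebra

/-! ## §2 The TWO-WITNESS visibility theorem (any number field `K`, odd `p`) -/

section TwoWitnesses

variable {K : Type} [Field K] [NumberField K] (W W' : WeierstrassCurve K) [W.IsElliptic]
  [W'.IsElliptic] {p : ℕ} [hp : Fact p.Prime]

/-- **Visibility with TWO explicit witnesses (rank-one shape).** Let `E = W`, `E' = W'` be elliptic
curves over a number field `K`, `p` an odd prime, `θ : E'[p] ⥲ E[p]` a `Γ_K`-equivariant isomorphism,
`S` a finite set of finite places containing every place of bad reduction of `E` or `E'` and every
place above `p`. Suppose `E(K)/pE(K)` is CYCLIC (`E(K) = ℤG + pE(K)` for some `G`; e.g. `E(K)` of rank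
one with `E(K)[p] = 0`) and let `P₁, P₂ ∈ E'(K)` be INDEPENDENT modulo `pE'(K)`
(`aP₁ + bP₂ ∈ pE'(K) ⟹ p ∣ a, b`) with transported Kummer classes `θ_* κ'(P_i)` satisfying the local
condition of `E` at every `v ∈ S`. **Then `Ш(E/K)` has a non-zero element killed by `p`** — one of the
two visible classes `f(P_i)` (`VisibleWitness.torsionH1ToH1_h1Equiv_kummerMapTorsion_mem_sha`): were
both zero, `θ_* κ'(P_i) = κ(Q_i) = a_i κ(G)` (`mem_range_kummerMapTorsion_of_torsionH1ToH1_eq_zero`,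
`κ(pE(K)) = 0`), so `θ_* κ'(a₂P₁ − a₁P₂) = 0`, `a₂P₁ − a₁P₂ ∈ pE'(K)` (`kummerMapTorsion_ker`),
`p ∣ a₁`, `θ_* κ'(P₁) = 0`, `P₁ ∈ pE'(K)`, `p ∣ 1`. Cremona–Mazur 2000 §3 / Agashe–Stein 2002 Lemma 3.6
in explicit form with the Mordell–Weil term of the target of dimension one. No index, no count.
[cite: CremonaMazur2000, §3] [cite: AgasheStein2002, Lemma 3.6] -/
theorem exists_sha_ne_zero_of_congr_of_two_witnesses (hp2 : p ≠ 2)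
    (θ : geomTorsion W' (p : ℤ) ≃+ geomTorsion W (p : ℤ))
    (hθ : ∀ (σ : absoluteGaloisGroup K) (P : geomTorsion W' (p : ℤ)), θ (σ • P) = σ • θ P)
    (S : Finset (HeightOneSpectrum (𝓞 K)))
    (hS : ∀ v : HeightOneSpectrum (𝓞 K), v ∉ S →
      W.HasGoodReductionAt v ∧ W'.HasGoodReductionAt v ∧ (p : 𝓞 K) ∉ v.asIdeal)
    (hdiv' : ∀ P : geomPoints W', ∃ Q : geomPoints W', (p : ℤ) • Q = P)
    (hE : ∃ G : W.toAffine.Point, ∀ Q : W.toAffine.Point,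
      ∃ (a : ℤ) (R : W.toAffine.Point), Q = a • G + (p : ℤ) • R)
    (P₁ P₂ : W'.toAffine.Point)
    (hind : ∀ a b : ℤ, a • P₁ + b • P₂ ∈
      (zsmulAddGroupHom (p : ℤ) : W'.toAffine.Point →+ W'.toAffine.Point).range →
      (p : ℤ) ∣ a ∧ (p : ℤ) ∣ b)
    (hloc₁ : ∀ v ∈ S, h1Equiv θ hθ (kummerMapTorsion W' (p : ℤ) hdiv' P₁) ∈
      selmerLocalKer W (v.adicCompletion K) (p : ℤ))
    (hloc₂ : ∀ v ∈ S, h1Equiv θ hθ (kummerMapTorsion W' (p : ℤ) hdiv' P₂) ∈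
      selmerLocalKer W (v.adicCompletion K) (p : ℤ)) :
    ∃ c : W.sha, c ≠ 0 ∧ p • c = 0 := by
  have hpp : p.Prime := Fact.out
  have hn : (p : ℤ) ≠ 0 := by exact_mod_cast hpp.ne_zero
  have hdiv : ∀ P : geomPoints W, ∃ Q : geomPoints W, (p : ℤ) • Q = P :=
    W.zsmul_geomPoints_surjective_holds hn
  obtain ⟨hsha₁, hpc₁⟩ :=
    VisibleWitness.torsionH1ToH1_h1Equiv_kummerMapTorsion_mem_sha W W' hp2 θ hθ S hS hdiv' P₁ hloc₁
  obtain ⟨hsha₂, hpc₂⟩ :=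
    VisibleWitness.torsionH1ToH1_h1Equiv_kummerMapTorsion_mem_sha W W' hp2 θ hθ S hS hdiv' P₂ hloc₂
  -- if one of the two visible classes is non-zero we are done
  by_cases h₁ : torsionH1ToH1 W (p : ℤ) (h1Equiv θ hθ (kummerMapTorsion W' (p : ℤ) hdiv' P₁)) = 0
  swap
  · exact ⟨⟨_, hsha₁⟩, fun h ↦ h₁ (congrArg Subtype.val h), Subtype.ext hpc₁⟩
  by_cases h₂ : torsionH1ToH1 W (p : ℤ) (h1Equiv θ hθ (kummerMapTorsion W' (p : ℤ) hdiv' P₂)) = 0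
  swap
  · exact ⟨⟨_, hsha₂⟩, fun h ↦ h₂ (congrArg Subtype.val h), Subtype.ext hpc₂⟩
  exfalso
  -- both vanish: the transported classes lie in the Kummer image of `E(K)`
  set κ := kummerMapTorsion W (p : ℤ) hdiv with hκ
  set κ' := kummerMapTorsion W' (p : ℤ) hdiv' with hκ'
  obtain ⟨Q₁, hQ₁⟩ := mem_range_kummerMapTorsion_of_torsionH1ToH1_eq_zero W (p : ℤ) hdiv _ h₁
  obtain ⟨Q₂, hQ₂⟩ := mem_range_kummerMapTorsion_of_torsionH1ToH1_eq_zero W (p : ℤ) hdiv _ h₂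
  obtain ⟨G, hG⟩ := hE
  obtain ⟨a₁, R₁, hR₁⟩ := hG Q₁
  obtain ⟨a₂, R₂, hR₂⟩ := hG Q₂
  -- `κ` kills `pE(K)`
  have hκp : ∀ R : W.toAffine.Point, κ ((p : ℤ) • R) = 0 := by
    intro R
    have hmem : (p : ℤ) • R ∈ κ.ker := by
      rw [hκ, kummerMapTorsion_ker W (p : ℤ) hdiv]
      exact ⟨R, rfl⟩
    exact hmem
  have hκQ₁ : κ Q₁ = a₁ • κ G := by rw [hR₁, map_add, map_zsmul, hκp, add_zero]
  have hκQ₂ : κ Q₂ = a₂ • κ G := by rw [hR₂, map_add, map_zsmul, hκp, add_zero]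
  -- `κ'` kills exactly `pE'(K)`
  have hκ'ker : ∀ P : W'.toAffine.Point, κ' P = 0 →
      P ∈ (zsmulAddGroupHom (p : ℤ) : W'.toAffine.Point →+ W'.toAffine.Point).range := by
    intro P hP0
    have hmem : P ∈ κ'.ker := hP0
    rwa [hκ', kummerMapTorsion_ker W' (p : ℤ) hdiv'] at hmem
  -- the combination `a₂ P₁ - a₁ P₂` has trivial transported class
  have hcomb : h1Equiv θ hθ (κ' (a₂ • P₁ + (-a₁) • P₂)) = 0 := by
    rw [map_add, map_zsmul, map_zsmul, map_add, map_zsmul, map_zsmul, ← hQ₁, ← hQ₂, hκQ₁, hκQ₂,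
      smul_smul, smul_smul, neg_mul, mul_comm a₁ a₂, neg_zsmul, add_neg_cancel]
  have hker : κ' (a₂ • P₁ + (-a₁) • P₂) = 0 :=
    (map_eq_zero_iff _ (h1Equiv θ hθ).injective).mp hcomb
  obtain ⟨-, hpa₁⟩ := hind a₂ (-a₁) (hκ'ker _ hker)
  obtain ⟨m, hm⟩ := (dvd_neg.mp hpa₁)
  -- hence `θ_* κ'(P₁) = a₁ κ(G) = m • κ(pG) = 0`
  have hP₁0 : κ' P₁ = 0 := by
    apply (map_eq_zero_iff _ (h1Equiv θ hθ).injective).mp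
    rw [← hQ₁, hκQ₁, hm, mul_comm, ← smul_smul, ← map_zsmul, hκp, zsmul_zero]
  obtain ⟨hp1, -⟩ := hind 1 0 (by rw [one_smul, zero_smul, add_zero]; exact hκ'ker _ hP₁0)
  exact hpp.one_lt.ne' (by exact_mod_cast Int.eq_one_of_dvd_one (Int.natCast_nonneg p) hp1)

end TwoWitnesses

/-! ## §3 The doors on cell (G-ord, `e = 2`) ∩ {`E[p]` irreducible} ∩ `r_an = 1` -/

section Doors

variable {W : WeierstrassCurve ℚ} [W.IsElliptic] [W.IsGloballyMinimal] {p : ℕ} [hp : Fact p.Prime]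

omit [W.IsGloballyMinimal] in
/-- `E(ℚ)/pE(ℚ)` is cyclic in analytic rank one with `E[p]` irreducible: Gross–Zagier–Kolyvagin
(`hGZK`: rank `E(ℚ) = r_an = 1`), Mordell–Weil (tree `module_finite_point_holds`), `E(ℚ)[p] = 0`
(irreducibility, tree `SelmerSha.torsionBy_point_eq_bot`), so `#E(ℚ)/pE(ℚ) = p^{rank} = p`
(tree `natCard_quotient_range_zsmul_eq`, Gross 1991 §2) and §1 applies.
[cite: GrossLMS1991, §2 (sentence after (2.2))] [cite: SilvermanAEC2009, Thm. VIII.6.7] -/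
theorem exists_generator_rankOne_of_irr (hGZK : rank_eq_analyticRank_of_analyticRank_le_one)
    (hirr : Irr W p) (hr : W.analyticRank = 1) :
    ∃ G : W.toAffine.Point, ∀ Q : W.toAffine.Point,
      ∃ (a : ℤ) (R : W.toAffine.Point), Q = a • G + (p : ℤ) • R := by
  have hpp : p.Prime := hp.out
  -- Mordell–Weil (the tree's theorem is stated with the classical `DecidableEq`; over `ℚ` the binders
  -- here carry `instDecidableEqRat` — the instances are equal, `Subsingleton`): `convert`.
  haveI : Module.Finite ℤ W.toAffine.Point := by convert W.module_finite_point_holds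
  have hrank : W.mordellWeilRank = 1 := by rw [(hGZK W (by rw [hr])).1, hr]
  have hfr : Module.finrank ℤ W.toAffine.Point = 1 := by
    have h := hrank
    unfold WeierstrassCurve.mordellWeilRank at h
    convert h
  have htors : AddSubgroup.torsionBy W.toAffine.Point (p : ℤ) = ⊥ := by
    have h := SelmerSha.torsionBy_point_eq_bot W p hirr 1
    simp only [pow_one] at h
    convert h using 2
  have hcard : Nat.card (W.toAffine.Point ⧸
      (zsmulAddGroupHom (α := W.toAffine.Point) (p : ℤ)).range) = p := by
    rw [natCard_quotient_range_zsmul_eq hpp htors, hfr, pow_one]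
  haveI : Finite (W.toAffine.Point ⧸ (zsmulAddGroupHom (α := W.toAffine.Point) (p : ℤ)).range) :=
    Nat.finite_of_card_ne_zero (by rw [hcard]; exact hpp.ne_zero)
  exact exists_generator_of_natCard_quotient_range_zsmul_le hpp hcard.le

/-- **`Ш(E)[p] ≠ 0` by two-witness visibility, cell (G-ord, `e = 2`) ∩ {`E[p]` irreducible} ∩ `r_an = 1`,
EVERY odd `p` (`p = 3` included), lean local options.** Published inputs: GZK (`hGZK`), Mazur–Rubin 2015
twisted (`hMRt`). Per-pair data (binders, decidable outside this file): the partner `W'` with its twist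
model `C' • V'^{(p*)} = W'`, `V'` GOOD at `p`; a `Γ_ℚ`-isomorphism `θ : W'[p] ⥲ W[p]`; the finite set `S`
of places (both curves good and `w ∤ p` outside); TWO points `P₁, P₂ ∈ W'(ℚ)` independent modulo
`pW'(ℚ)`; and, for each of them at each `w ∈ S`: (a) a `p`-th root in `W'(ℚ_w)`, or (i) `w ∤ p` with
`W'(ℚ_w)[p] = 0`, or (vi) `w ∣ p`. The cell supplies `W`'s own twist model
(`TypeGOrd.exists_goodOrd_pStar_twist_model`); GZK + irreducibility supply the cyclicity of `E(ℚ)/pE(ℚ)`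
(`exists_generator_rankOne_of_irr`). Per pair; NOT a class theorem.
[cite: MazurRubin2015SelmerCompanions, Thm. 3.1 and §6 Case 5] [cite: CremonaMazur2000, §3]
[cite: AgasheStein2002, Lemma 3.6] -/
theorem exists_sha_ne_zero_rankOne_irr_of_companionTwoWitnesses
    (hGZK : rank_eq_analyticRank_of_analyticRank_le_one)
    (hMRt : selmerLocalKer_iff_of_twist_of_goodReduction_above)
    (hc : N10.CellGordTwo W p) (hirr : Irr W p) (hr : W.analyticRank = 1)
    (W' : WeierstrassCurve ℚ) [W'.IsElliptic] (V' : WeierstrassCurve ℚ) [V'.IsElliptic]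
    (C' : VariableChange ℚ) (hWV' : C' • V'.quadraticTwist ((-1 : ℚ) ^ (p / 2) * p) = W')
    (hV' : V'.HasGoodReductionAtPrime p)
    (θ : geomTorsion W' (p : ℤ) ≃+ geomTorsion W (p : ℤ))
    (hθ : ∀ (σ : absoluteGaloisGroup ℚ) (P : geomTorsion W' (p : ℤ)), θ (σ • P) = σ • θ P)
    (S : Finset (HeightOneSpectrum (𝓞 ℚ)))
    (hS : ∀ w : HeightOneSpectrum (𝓞 ℚ), w ∉ S →
      W.HasGoodReductionAt w ∧ W'.HasGoodReductionAt w ∧ (p : 𝓞 ℚ) ∉ w.asIdeal)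
    (P₁ P₂ : W'.toAffine.Point)
    (hind : ∀ a b : ℤ, a • P₁ + b • P₂ ∈
      (zsmulAddGroupHom (p : ℤ) : W'.toAffine.Point →+ W'.toAffine.Point).range →
      (p : ℤ) ∣ a ∧ (p : ℤ) ∣ b)
    (hplaces : ∀ P ∈ [P₁, P₂], ∀ w ∈ S,
      (∃ Q : (W'.baseChange (w.adicCompletion ℚ)).toAffine.Point,
        p • Q = WeierstrassCurve.Affine.Point.baseChange (W' := W') ℚ (w.adicCompletion ℚ) P) ∨
      ((p : 𝓞 ℚ) ∉ w.asIdeal ∧ Nat.card (nsmulAddMonoidHom p :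
          (W'.baseChange (w.adicCompletion ℚ)).toAffine.Point →+ _).ker = 1) ∨
      ((p : 𝓞 ℚ) ∈ w.asIdeal)) :
    ∃ c : W.sha, c ≠ 0 ∧ p • c = 0 := by
  have hpp : p.Prime := hp.out
  have hn : (p : ℤ) ≠ 0 := by exact_mod_cast hpp.ne_zero
  obtain ⟨hp2, hadd, hG, he⟩ := hc
  obtain ⟨V, _, _, C, hVord, hWV⟩ := TypeGOrd.exists_goodOrd_pStar_twist_model W p hp2 hG hadd he
  have hdiv' : ∀ Q : geomPoints W', ∃ R : geomPoints W', (p : ℤ) • R = Q :=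
    W'.zsmul_geomPoints_surjective_holds hn
  obtain ⟨G, hG⟩ := exists_generator_rankOne_of_irr (W := W) (p := p) hGZK hirr hr
  -- §2 is stated for a general number field with the classical `DecidableEq`; over `ℚ` the binders here
  -- carry `instDecidableEqRat` (equal instances, `Subsingleton`): transport pointwise with `convert`.
  refine exists_sha_ne_zero_of_congr_of_two_witnesses W W' hp2 θ hθ S hS hdiv' ⟨G, fun Q ↦ ?_⟩ P₁ P₂
    (fun a b hab ↦ hind a b (by convert hab))
    (fun w hw ↦ h1Equiv_kummerMapTorsion_mem_selmerLocalKer_of_witness_twist hMRt hp2 θ hθ V V' C C'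
      (pStar_ne_zero p) hWV hWV' hVord.1 hV' hdiv' P₁ w (hplaces P₁ (by simp) w hw))
    (fun w hw ↦ h1Equiv_kummerMapTorsion_mem_selmerLocalKer_of_witness_twist hMRt hp2 θ hθ V V' C C'
      (pStar_ne_zero p) hWV hWV' hVord.1 hV' hdiv' P₂ w (hplaces P₂ (by simp) w hw))
  obtain ⟨a, R, h⟩ := hG Q
  exact ⟨a, R, by convert h⟩

/-- **The LOWER half by two-witness visibility, cell (G-ord, `e = 2`) ∩ {`E[p]` irreducible} ∩
`r_an = 1`, EVERY odd `p` (`p = 3` included): the CONTENT-window door.** Published inputs (binders):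
Cassels–Tate (`hCT`), GZK (`hGZK`), Mazur–Rubin 2015 twisted (`hMRt`). Per-pair data as in
`exists_sha_ne_zero_rankOne_irr_of_companionTwoWitnesses`, plus the datum `#Ш(E)_an = q` with
`ord_p q ≤ 2`. Chain: two-witness visibility ⟹ `Ш(E)[p] ≠ 0` ⟹ `p ∣ #Ш(E)` ⟹ Cassels–Tate squareness
(`missingLowerBoundAt_of_casselsTate_of_pow_dvd`) ⟹ `ord_p #Ш(E)_an ≤ 2 ≤ ord_p #Ш(E)`. NO Λ-adic /
Kato / EPW / GV / Delbourgo binder, NO `p`-adic `L`-value, NO `p`-adic height (`A′`), NO engine value.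
Per pair; NOT a class theorem; the crux stays OPEN. [cite: MazurRubin2015SelmerCompanions, Thm. 3.1 and §6 Case 5]
[cite: CremonaMazur2000, §3] [cite: AgasheStein2002, Lemma 3.6] [cite: SilvermanAEC2009, Thm. X.4.14] -/
theorem missingLowerBoundAt_rankOne_irr_of_companionTwoWitnesses
    (hCT : exists_casselsTate_pairing (K := ℚ)) (hGZK : rank_eq_analyticRank_of_analyticRank_le_one)
    (hMRt : selmerLocalKer_iff_of_twist_of_goodReduction_above)
    (hc : N10.CellGordTwo W p) (hirr : Irr W p) (hr : W.analyticRank = 1)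
    {q : ℚ} (hq : shaAn W = (q : ℂ)) (hv : padicValRat p q ≤ 2)
    (W' : WeierstrassCurve ℚ) [W'.IsElliptic] (V' : WeierstrassCurve ℚ) [V'.IsElliptic]
    (C' : VariableChange ℚ) (hWV' : C' • V'.quadraticTwist ((-1 : ℚ) ^ (p / 2) * p) = W')
    (hV' : V'.HasGoodReductionAtPrime p)
    (θ : geomTorsion W' (p : ℤ) ≃+ geomTorsion W (p : ℤ))
    (hθ : ∀ (σ : absoluteGaloisGroup ℚ) (P : geomTorsion W' (p : ℤ)), θ (σ • P) = σ • θ P)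
    (S : Finset (HeightOneSpectrum (𝓞 ℚ)))
    (hS : ∀ w : HeightOneSpectrum (𝓞 ℚ), w ∉ S →
      W.HasGoodReductionAt w ∧ W'.HasGoodReductionAt w ∧ (p : 𝓞 ℚ) ∉ w.asIdeal)
    (P₁ P₂ : W'.toAffine.Point)
    (hind : ∀ a b : ℤ, a • P₁ + b • P₂ ∈
      (zsmulAddGroupHom (p : ℤ) : W'.toAffine.Point →+ W'.toAffine.Point).range →
      (p : ℤ) ∣ a ∧ (p : ℤ) ∣ b)
    (hplaces : ∀ P ∈ [P₁, P₂], ∀ w ∈ S,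
      (∃ Q : (W'.baseChange (w.adicCompletion ℚ)).toAffine.Point,
        p • Q = WeierstrassCurve.Affine.Point.baseChange (W' := W') ℚ (w.adicCompletion ℚ) P) ∨
      ((p : 𝓞 ℚ) ∉ w.asIdeal ∧ Nat.card (nsmulAddMonoidHom p :
          (W'.baseChange (w.adicCompletion ℚ)).toAffine.Point →+ _).ker = 1) ∨
      ((p : 𝓞 ℚ) ∈ w.asIdeal)) :
    MissingLowerBoundAt W p := by
  have hex : ∃ c : W.sha, c ≠ 0 ∧ p • c = 0 :=
    exists_sha_ne_zero_rankOne_irr_of_companionTwoWitnesses hGZK hMRt hc hirr hr W' V' C' hWV' hV' θ hθ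
      S hS P₁ P₂ hind hplaces
  have hfinSha : W.ShaFinite := (hGZK W (by rw [hr])).2
  exact missingLowerBoundAt_of_casselsTate_of_pow_dvd W p hCT hfinSha hq (k := 1) (by simpa using hv)
    (by simpa using dvd_shaOrder_of_exists_torsion W p hex)

end Doors

end Summit.BirchSwinnertonDyer.BirchSwinnertonDyer.Theorems.AdditiveBranchIMCGordTwoRankOneVisibility

end
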